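import Literature.NumberTheory.EllipticCurves.KugaSatoVariety
import HarnessLib

/-!
# Base change of elliptic curves and level structures over a scheme

Topic: `Literature/NumberTheory/EllipticCurves`. Companion to `KugaSatoVariety.lean`, which defines
elliptic curves over a base scheme (`EllCurveOver S`, a group object of `Over S` that is proper,
smooth of relative dimension `1`, with geometrically connected fibres), full level-`N` structures
(`EllCurveOver.LevelStructure`), the fine moduli scheme `FullLevelModularCurve K N` and the
structure `KugaSatoVariety K m N`, and records their existence as the named fact
`nonempty_kugaSatoVariety`.

This file supplies the first piece of API that every use of the universal property
`FullLevelModularCurve.classify` and every assembly of a `KugaSatoVariety` (restriction of the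
universal pair `(E, φ)` to a component `Y ↪ Y(N)_K`, field `curve_isBaseChange`) needs, and which
the moduli problem itself presupposes: **elliptic curves with level structure pull back along
morphisms of the base** (Katz–Mazur (2.1): "the formation of `E/S` commutes with arbitrary base
change"; (3.1): a level structure on `E/S` induces one on `E_T/T` for every `T → S`; Deligne
(3.6): the moduli problem `n ↦ (E, α)` is a functor in `S`).

## Content (all proved, no named facts)

* `EllCurveOver.baseChange C g` — the elliptic curve `E ×_S S' → S'` for `g : S' ⟶ S`: the object
  `(Over.pullback g).obj E` with the group structure transported by the cartesian-monoidal
  functor `Over.pullback g` (Mathlib `Functor.grpObjObj`); properness, smoothness of relative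
  dimension `1` and geometric connectedness of fibres are stable under base change (Mathlib).
* `EllCurveOver.isBaseChangeVia_baseChange` — the projection `E ×_S S' → E` is a base change of
  group schemes in the sense of `EllCurveOver.IsBaseChangeVia` (cartesian, compatible with the
  identity sections and the group laws).
* `EllCurveOver.sectionsBaseChange` — pull-back of sections `E(S) →* (E ×_S S')(S')` as a group
  homomorphism, with its defining equations on the two projections.
* `EllCurveOver.fibrePointsEquiv` — for a field-valued point `s' : Spec Ω → S'`, the fibre of
  `E ×_S S'` over `s'` and the fibre of `E` over `s' ≫ g` have the same `Ω`-points, as groups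
  (the adjunction `Over.map g ⊣ Over.pullback g`), compatibly with restriction of sections
  (`fibrePointsEquiv_restrict`).
* `EllCurveOver.LevelStructure.baseChange φ g` — the pulled-back level-`N` structure
  `(P ∘ g, Q ∘ g)` on `E ×_S S'`, and `LevelStructure.isBaseChangeVia_baseChange`: it is identified
  with `φ` along the projection, in the sense of `LevelStructure.IsBaseChangeVia`.

Implementation note. Statements such as `η[E'].left ≫ G = g ≫ η[E].left` (from
`EllCurveOver.IsBaseChangeVia`) identify `(𝟙_ (Over S')).left` with `S'` and
`((Over.map g).obj A).hom` with `A.hom ≫ g`, which hold by unfolding the (semireducible) chosen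
finite products of `Over S'`; as in `Mathlib.CategoryTheory.Monoidal.Cartesian.Over`, the proofs
that rewrite under such identifications are run with `backward.isDefEq.respectTransparency false`.

## References

* N. Katz, B. Mazur, *Arithmetic moduli of elliptic curves*, Ann. Math. Stud. 108 (1985), (2.1),
  (3.1). [KatzMazur1985]
* P. Deligne, *Formes modulaires et représentations ℓ-adiques*, Sém. Bourbaki 355 (1969), (3.6).
  [Deligne1971Bourbaki355]
-/

universe u

open CategoryTheory Limits AlgebraicGeometry MonoidalCategory CartesianMonoidalCategory
open Functor.LaxMonoidal
open scoped MonObj Obj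

noncomputable section

namespace Literature.NumberTheory.EllipticCurves

namespace EllCurveOver

variable {S S' : Scheme.{u}} (C : EllCurveOver S) (g : S' ⟶ S)

/-- **Base change of an elliptic curve.** For `E → S` an elliptic curve over `S` and `g : S' → S`,
the elliptic curve `E ×_S S' → S'`: the `S'`-scheme `(Over.pullback g).obj E`
(underlying scheme `pullback E.hom g`, structure map `pullback.snd`), with the `S'`-group-scheme
structure obtained by transporting the group object `E` of `Over S` along the cartesian-monoidal
functor `Over.pullback g : Over S ⥤ Over S'`; it is proper, smooth of relative dimension `1` and
has geometrically connected fibres because these properties are stable under base change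
(Katz–Mazur (2.1): "the formation of `E/S` commutes with arbitrary base change").
[cite: KatzMazur1985, (2.1)] -/
abbrev baseChange : EllCurveOver S' where
  E := (Over.pullback g).obj C.E
  grpObj := Functor.grpObjObj (F := Over.pullback g)
  isProper := MorphismProperty.pullback_snd (P := @IsProper) _ _ C.isProper
  smooth :=
    haveI := smoothOfRelativeDimension_isStableUnderBaseChange (n := 1)
    MorphismProperty.pullback_snd (P := @SmoothOfRelativeDimension 1) _ _ C.smooth
  geometricallyConnected :=
    MorphismProperty.pullback_snd (P := @GeometricallyConnected) _ _ C.geometricallyConnected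

/-- The total space of the base change is the `S'`-scheme `(Over.pullback g).obj E`. [folklore] -/
theorem baseChange_E : (C.baseChange g).E = (Over.pullback g).obj C.E := rfl

/-- The underlying scheme of `E ×_S S'` is Mathlib's `pullback E.hom g`. [folklore] -/
theorem baseChange_E_left : (C.baseChange g).E.left = pullback C.E.hom g := rfl

/-- The structure morphism of `E ×_S S' → S'` is the second projection. [folklore] -/
theorem baseChange_E_hom : (C.baseChange g).E.hom = pullback.snd C.E.hom g := rfl

/-- The identity section of `E ×_S S'` is the transport `ε ≫ (Over.pullback g).map η` of the
identity section of `E`. [folklore] -/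
theorem baseChange_one :
    η[(C.baseChange g).E] = ε (Over.pullback g) ≫ (Over.pullback g).map η[C.E] := rfl

/-- The group law of `E ×_S S'` is the transport `μ ≫ (Over.pullback g).map μ[E]` of the group law
of `E`. [folklore] -/
theorem baseChange_mul :
    μ[(C.baseChange g).E] =
      Functor.LaxMonoidal.μ (Over.pullback g) C.E C.E ≫ (Over.pullback g).map μ[C.E] := rfl

/-- In the square `S' ×_S S ⇉ S', S`, the inverse of the (invertible) projection to `S'` followed
by the projection to `S` is `g`. [folklore] -/
@[reassoc]
theorem inv_pullback_snd_id_comp_fst :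
    inv (pullback.snd (𝟙 S) g) ≫ pullback.fst (𝟙 S) g = g := by
  rw [IsIso.inv_comp_eq, ← Category.comp_id (pullback.fst (𝟙 S) g), pullback.condition]

-- `(𝟙_ (Over S')).left = S'` holds by unfolding the chosen finite products of `Over S'`
-- (cf. `Mathlib.CategoryTheory.Monoidal.Cartesian.Over`, which uses the same option).
set_option backward.isDefEq.respectTransparency false in
/-- For a section `P` of `E → S`, the transported morphism `ε ≫ (Over.pullback g).map P` followed
by the projection `E ×_S S' → E` is `P ∘ g` on underlying schemes. [folklore] -/
theorem ε_map_left_fst (P : C.Sections) :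
    (ε (Over.pullback g) ≫ (Over.pullback g).map P).left ≫ pullback.fst C.E.hom g =
      g ≫ P.left := by
  simp only [Over.comp_left, Over.ε_pullback_left, Over.pullback_map_left, Category.assoc,
    pullback.lift_fst]
  dsimp only [Over.tensorUnit_hom, Over.tensorUnit_left]
  rw [inv_pullback_snd_id_comp_fst_assoc]

-- as above: the statement lives over the identification `(𝟙_ (Over S')).left = S'`.
set_option backward.isDefEq.respectTransparency false in
/-- **The projection `E ×_S S' → E` is a base change of group schemes** along `g`
(`EllCurveOver.IsBaseChangeVia`): the square is cartesian, and the projection carries the identity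
section and the group law of `E ×_S S'` to those of `E` (Katz–Mazur (2.1)).
[cite: KatzMazur1985, (2.1)] -/
theorem isBaseChangeVia_baseChange :
    (C.baseChange g).IsBaseChangeVia C g (pullback.fst C.E.hom g) := by
  refine ⟨pullback.condition, IsPullback.of_hasPullback _ _, C.ε_map_left_fst g η[C.E], ?_⟩
  rw [baseChange_mul, Over.comp_left, Category.assoc]
  have h : ((Over.pullback g).map μ[C.E]).left ≫ pullback.fst C.E.hom g =
      pullback.fst (C.E ⊗ C.E).hom g ≫ μ[C.E].left := by
    simp only [Over.pullback_map_left, pullback.lift_fst]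
  rw [h, ← Category.assoc]
  congr 1
  apply pullback.hom_ext
  · simp only [Category.assoc, pullback.lift_fst]
    exact Over.μ_pullback_left_fst_fst C.E C.E
  · simp only [Category.assoc, pullback.lift_snd]
    exact Over.μ_pullback_left_fst_snd C.E C.E

/-- **Pull-back of sections.** The group homomorphism `E(S) → (E ×_S S')(S')`,
`P ↦ (P ∘ g, 𝟙)`, realised as `P ↦ ε ≫ (Over.pullback g).map P` for the monoidal functor
`Over.pullback g` (Katz–Mazur (2.1), (3.1): sections and level structures pull back).
[cite: KatzMazur1985, (3.1)] -/
def sectionsBaseChange : C.Sections →* (C.baseChange g).Sections where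
  toFun P := ε (Over.pullback g) ≫ (Over.pullback g).map P
  map_one' := by rw [Functor.map_one, MonObj.comp_one]
  map_mul' P Q := by rw [Functor.map_mul, MonObj.comp_mul]

/-- Unfolding of `sectionsBaseChange`. [folklore] -/
theorem sectionsBaseChange_apply (P : C.Sections) :
    C.sectionsBaseChange g P = ε (Over.pullback g) ≫ (Over.pullback g).map P := rfl

/-- The pulled-back section followed by the projection to `E` is `P ∘ g`. [folklore] -/
theorem sectionsBaseChange_left_fst (P : C.Sections) :
    (C.sectionsBaseChange g P).left ≫ pullback.fst C.E.hom g = g ≫ P.left :=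
  C.ε_map_left_fst g P

/-- The pulled-back section is a section of `E ×_S S' → S'`. [folklore] -/
theorem sectionsBaseChange_left_snd (P : C.Sections) :
    (C.sectionsBaseChange g P).left ≫ pullback.snd C.E.hom g = 𝟙 S' :=
  Over.w (C.sectionsBaseChange g P)

/-- The identity section pulls back to the identity section. [folklore] -/
theorem sectionsBaseChange_one' : C.sectionsBaseChange g η[C.E] = η[(C.baseChange g).E] := rfl

/-! ### Points of `E` over an `S'`-scheme versus points of `E ×_S S'` -/

variable (A : Over S')

/-- Two morphisms into `(Over.pullback g).obj (𝟙_ (Over S))` (a terminal object, `ε` being an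
isomorphism) agree. [folklore] -/
theorem hom_pullback_tensorUnit_ext (a b : A ⟶ (Over.pullback g).obj (𝟙_ (Over S))) : a = b := by
  rw [← cancel_mono (inv (ε (Over.pullback g)))]
  exact toUnit_unique _ _

-- `(𝟭 _).obj A = A`, `(Over.map g ⋙ Over.pullback g).obj A = _` by unfolding (types of `adj.unit`).
set_option backward.isDefEq.respectTransparency false in
/-- The transposition `Hom_S(A, E) ≃ Hom_{S'}(A, E ×_S S')` of the adjunction
`Over.map g ⊣ Over.pullback g` is multiplicative for the group structures induced by the group
object `E` and its transport `E ×_S S'` (because `Over.pullback g` is a monoidal functor).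
[folklore] -/
theorem mapPullbackAdj_homEquiv_mul (x y : (Over.map g).obj A ⟶ C.E) :
    (Over.mapPullbackAdj g).homEquiv A C.E (x * y) =
      (Over.mapPullbackAdj g).homEquiv A C.E x * (Over.mapPullbackAdj g).homEquiv A C.E y := by
  rw [Adjunction.homEquiv_unit, Adjunction.homEquiv_unit, Adjunction.homEquiv_unit,
    Functor.map_mul, MonObj.comp_mul]

-- as above (types of `adj.unit`).
set_option backward.isDefEq.respectTransparency false in
/-- Transposition of `A → 𝟙 → E` (a section made constant on `A`) is the constant point
`A → 𝟙 → E ×_S S'` of the transported section. [folklore] -/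
theorem mapPullbackAdj_homEquiv_toUnit_comp (P : C.Sections) :
    (Over.mapPullbackAdj g).homEquiv A C.E (toUnit _ ≫ P) =
      toUnit A ≫ ε (Over.pullback g) ≫ (Over.pullback g).map P := by
  rw [Adjunction.homEquiv_unit, Functor.map_comp, ← Category.assoc, ← Category.assoc]
  congr 1
  exact hom_pullback_tensorUnit_ext g A _ _

-- `((Over.map g).obj A).hom = A.hom ≫ g` by unfolding `Over.map`.
set_option backward.isDefEq.respectTransparency false in
/-- On underlying schemes, the transpose of `x : A → E` is `(x, A → S') : A → E ×_S S'`; in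
particular its first component is `x`. [folklore] -/
theorem mapPullbackAdj_homEquiv_left_fst (x : (Over.map g).obj A ⟶ C.E) :
    ((Over.mapPullbackAdj g).homEquiv A C.E x).left ≫ pullback.fst C.E.hom g = x.left := by
  simp [Over.mapPullbackAdj]

variable {Ω : Type u} [Field Ω] (s' : Spec (.of Ω) ⟶ S')

/-- **Fibres of the base change.** For a field-valued point `s' : Spec Ω → S'`, the `Ω`-points of
the fibre of `E` over `s' ≫ g` and of the fibre of `E ×_S S'` over `s'` are identified, as groups,
by the adjunction `Over.map g ⊣ Over.pullback g` (`x ↦ (x, s')`; note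
`(Over.map g).obj (Over.mk s') = Over.mk (s' ≫ g)`). [folklore] -/
def fibrePointsEquiv : C.FibrePoints (s' ≫ g) ≃* (C.baseChange g).FibrePoints s' where
  toEquiv := (Over.mapPullbackAdj g).homEquiv (Over.mk s') C.E
  map_mul' := C.mapPullbackAdj_homEquiv_mul g (Over.mk s')

/-- `fibrePointsEquiv` is the transposition of the adjunction `Over.map g ⊣ Over.pullback g`.
[folklore] -/
theorem fibrePointsEquiv_apply (x : C.FibrePoints (s' ≫ g)) :
    C.fibrePointsEquiv g s' x = (Over.mapPullbackAdj g).homEquiv (Over.mk s') C.E x :=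
  rfl

/-- On underlying schemes, `fibrePointsEquiv x` is `(x, s') : Spec Ω → E ×_S S'`. [folklore] -/
theorem fibrePointsEquiv_left_fst (x : C.FibrePoints (s' ≫ g)) :
    (C.fibrePointsEquiv g s' x).left ≫ pullback.fst C.E.hom g = x.left :=
  C.mapPullbackAdj_homEquiv_left_fst g (Over.mk s') x

/-- **Restriction of sections commutes with base change**: restricting the pulled-back section
`P ∘ g` to the fibre over `s'` gives the point corresponding, under `fibrePointsEquiv`, to the
restriction of `P` to the fibre over `s' ≫ g`. [folklore] -/
theorem fibrePointsEquiv_restrict (P : C.Sections) :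
    C.fibrePointsEquiv g s' (C.restrict (s' ≫ g) P) =
      (C.baseChange g).restrict s' (C.sectionsBaseChange g P) :=
  C.mapPullbackAdj_homEquiv_toUnit_comp g (Over.mk s') P

namespace LevelStructure

variable {C} {N : ℕ} (φ : LevelStructure N C)

/-- **Base change of a level structure** (Katz–Mazur (3.1); Deligne (3.6)): the pulled-back
sections `(P ∘ g, Q ∘ g)` form a full level-`N` structure on `E ×_S S'` — they are `N`-torsion
because pull-back of sections is a homomorphism, and a `ℤ/N`-basis of the `N`-torsion of every
geometric fibre because the fibre of `E ×_S S'` over `s'` is the fibre of `E` over `s' ≫ g`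
(`fibrePointsEquiv`). [cite: KatzMazur1985, (3.1)] -/
def baseChange (g : S' ⟶ S) : LevelStructure N (C.baseChange g) where
  P := C.sectionsBaseChange g φ.P
  Q := C.sectionsBaseChange g φ.Q
  pow_P := by rw [← map_pow, φ.pow_P, map_one]
  pow_Q := by rw [← map_pow, φ.pow_Q, map_one]
  basis_injective Ω _ _ s := by
    have key : (fun ab : ZMod N × ZMod N =>
        (C.baseChange g).restrict s
          (C.sectionsBaseChange g φ.P ^ ab.1.val * C.sectionsBaseChange g φ.Q ^ ab.2.val)) =
        C.fibrePointsEquiv g s ∘ fun ab : ZMod N × ZMod N =>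
          C.restrict (s ≫ g) (φ.P ^ ab.1.val * φ.Q ^ ab.2.val) := by
      funext ab
      rw [Function.comp_apply, ← map_pow, ← map_pow, ← map_mul, fibrePointsEquiv_restrict]
    rw [key]
    exact (C.fibrePointsEquiv g s).injective.comp (φ.basis_injective (s ≫ g))
  basis_surjective Ω _ _ s x hx := by
    obtain ⟨ab, hab⟩ := φ.basis_surjective (s ≫ g) ((C.fibrePointsEquiv g s).symm x)
      (by rw [← map_pow, hx, map_one])
    refine ⟨ab, ?_⟩
    rw [← map_pow, ← map_pow, ← map_mul, ← fibrePointsEquiv_restrict, hab,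
      MulEquiv.apply_symm_apply]

/-- The first section of the pulled-back level structure is `P ∘ g`. [folklore] -/
@[simp]
theorem baseChange_P (g : S' ⟶ S) : (φ.baseChange g).P = C.sectionsBaseChange g φ.P := rfl

/-- The second section of the pulled-back level structure is `Q ∘ g`. [folklore] -/
@[simp]
theorem baseChange_Q (g : S' ⟶ S) : (φ.baseChange g).Q = C.sectionsBaseChange g φ.Q := rfl

/-- Pull-back of level structures commutes with `φ(a, b) = P^a Q^b`. [folklore] -/
theorem baseChange_section_ (g : S' ⟶ S) (ab : ZMod N × ZMod N) :
    (φ.baseChange g).section_ ab = C.sectionsBaseChange g (φ.section_ ab) := by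
  simp only [section_, baseChange_P, baseChange_Q, map_mul, map_pow]

/-- **The projection identifies the pulled-back level structure with `φ`**: along
`E ×_S S' → E` over `g`, the pair `(E ×_S S', φ ∘ g)` is the base change of `(E, φ)` in the sense
of `LevelStructure.IsBaseChangeVia` (Katz–Mazur (3.1), functoriality in `S`; Deligne (3.6),
morphisms of pairs `(E, α)`). [cite: KatzMazur1985, (3.1)] -/
theorem isBaseChangeVia_baseChange (g : S' ⟶ S) :
    (φ.baseChange g).IsBaseChangeVia φ g (pullback.fst C.E.hom g) :=
  ⟨C.isBaseChangeVia_baseChange g, C.sectionsBaseChange_left_fst g φ.P,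
    C.sectionsBaseChange_left_fst g φ.Q⟩

end LevelStructure

end EllCurveOver

end Literature.NumberTheory.EllipticCurves

end
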